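import Mathlib.Analysis.Calculus.ContDiff.Defs
import Mathlib.Analysis.SpecialFunctions.Trigonometric.Basic
import Mathlib.MeasureTheory.Integral.Bochner.Basic
import Mathlib.MeasureTheory.Integral.Lebesgue.Basic
import Mathlib.MeasureTheory.Constructions.Pi
import Mathlib.MeasureTheory.Measure.Lebesgue.Basic
import Mathlib.Data.Fintype.Pi
import Mathlib.Order.Filter.Cofinite
import Literature.Probability.LatticeModels.ThermodynamicLimit
import Literature.MathematicalPhysics.QuantumLattice.LatticeTori
import HarnessLib

/-!
# Ground-state long-range order of ferromagnetic quantum rotators (variational vocabulary)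

Quantum rotators (rotors) on a finite set of sites `Λ`: angles `φ(x) ∈ [-π, π)`, Hilbert space
`⊗_{x ∈ Λ} L²([-π, π])`, and the Hamiltonian of Klein–Perez (Commun. Math. Phys. 147 (1992),
eq. (2.1) and the Remark of §2; §3: `h₀ = -½ d²/dφ²` with periodic boundary condition in the angle)

  `H_Λ = Σ_{x ∈ Λ} (h/2) (-∂²/∂φ(x)²) - J Σ_{⟨x,y⟩ ⊂ Λ} cos(φ(x) - φ(y))`,

`h > 0` the inverse moment of inertia, `J > 0` the ferromagnetic coupling, the second sum over
nearest-neighbour pairs. `H_Λ` has discrete spectrum and a unique, positive ground state `Ω_Λ`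
(p. 242); the ground-state correlations are
`⟨cos(φ(x) - φ(y))⟩_Λ = (Ω_Λ, cos(φ(x) - φ(y)) Ω_Λ)` (2.3). Klein–Perez record (p. 243, for the
homogeneous model `h(x) ≡ h`): "In its ground state for `d ≥ 2`, it exhibits a phase transition
with long range order for `α = J/h > α_c(d)`. This follows from the path space representation
developed in Sect. 3 and standard techniques [6]" — [6] = Driessler–Landau–Perez, J. Stat.
Phys. 20 (1979) 123–162 (reflection positivity and infrared bounds). The theorem behind this remark
is in print, with proof, as Wojtkiewicz–Pusz–Stachura, Rep. Math. Phys. 77 (2016) 183–209,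
Thm. 3.3 (every `d` with `𝓘_d < ∞`, i.e. `d ≥ 2`; `d = 2` earlier in Wojtkiewicz, Physica A 391
(2012) 5918–5925, Thm. 1): reflection positivity on the discrete TORUS of even side (periodic
boundary conditions, [WojtkiewiczPuszStachura2016, §3.1]) and the Kennedy–Lieb–Shastry `T = 0`
infrared bound give a positive ORDER PARAMETER `⟨(|Λ|⁻¹ Σ_x cos φ_x)²⟩ ≥ C > 0` in the (unique,
[ibid., Prop. 3.2]) ground state of all large even tori, as soon as `√(J/h) > 𝓘_d`.

This file gives that theorem a home as the NAMED FACT `KleinPerez1992_rotorGroundStateLRO`, over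
an honest **variational** vocabulary in the style of
`Literature.MathematicalPhysics.QuantumManyBody.BoseGas.PeriodicTrialState` (no unbounded
operators): trial states are `C¹`, `2π`-periodic wave functions `Ψ(φ)` normalised on the cell
`[-π, π)^Λ`; the energy is the quadratic form of `H_Λ + J·#bonds ≥ 0`,
`𝓔(Ψ) = ∫ (h/2) Σ_x |∂_{φ(x)} Ψ|² + (J/2) Σ_x Σ_{y ∼ x} (1 - cos(φ(x) - φ(y))) |Ψ|²` (each bond
twice in the double sum, whence `J/2`; the additive constant does not change minimisers); the
ground-state energy is its infimum; and the GROUND-STATE EXPECTATION of the bounded observable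
`cos(φ(x) - φ(y))` is rendered as `lim_{δ ↓ 0} sup {⟨cos(φ_x - φ_y)⟩_Ψ : 𝓔(Ψ) ≤ E₀ + δ}`
(`groundStateCorrelation`), which IS `(Ω_Λ, cos(φ_x - φ_y) Ω_Λ)` because the ground state is
unique, smooth and isolated in the spectrum (Klein–Perez p. 242; [WojtkiewiczPuszStachura2016,
Thm. 3.1, Prop. 3.2]: discrete spectrum, positivity improving semigroup). The neighbour relation is
a parameter: the nearest-neighbour graph of the discrete torus `(ℤ/Lℤ)^d`
(`Literature.Probability.LatticeModels.torusGraph`, periodic boundary conditions —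
`torusCorrelation`, the object of the published theorems and of the named fact) or the
nearest-neighbour bonds inside a box `{-L, …, L}^d ⊂ ℤ^d` (free boundary conditions —
`boxCorrelation`, `infiniteVolumeCorrelation`, Klein–Perez's own finite volumes (2.1)–(2.3), kept
as vocabulary). "Long range order" is the tree's `HasLongRangeOrder` along the even tori
`(ℤ/2kℤ)^d`: `liminf_k (2k)^{-2d} Σ_{x,y} ⟨cos(φ_x - φ_y)⟩_{(ℤ/2kℤ)^d} > 0` (the `HasEvenTorusLRO`
idiom of `XYOrder.lean`, written out so as not to import the matrix vocabulary).

## What is NOT here (and why)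

* Klein–Perez's literal phrasing in their free-boundary-condition vocabulary — non-decay of the
  infinite-volume two-point function `G(0, y) = lim_{Λ ↑ ℤ^d} ⟨cos(φ(0) - φ(y))⟩_Λ` — is NOT the
  statement vendored: no proof of it is in print (Klein–Perez give none beyond "standard techniques
  [6]"), and it does not follow from the torus theorem by monotonicity (by the Ginibre inequalities
  of the path-space representation, p. 243, free-boundary correlations are DOMINATED BY the periodic
  ones — the torus carries more ferromagnetic bonds —, so a lower bound on the torus order parameter
  does not transfer). An earlier revision of this file rendered the fact that way; it was restated
  (review of 2026-08-15) to the periodic form the cited proofs establish. The free-boundary objects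
  `boxCorrelation`/`infiniteVolumeCorrelation` and their well-definedness layer
  (`QuantumRotorGroundStateProofs.lean`) are kept.
* The positive-temperature results for QUANTUM ANHARMONIC CRYSTALS (the `φ⁴`/double-well
  "ferroelectric" models of Pastur–Khoruzhenko 1987 and Driessler–Landau–Perez 1979): in print
  with full proofs as Kargol–Kondratiev–Kozitsky, Rev. Math. Phys. 20 (2008), Thms. 3.20–3.21
  (`d ≥ 3`, every `β`, large mass `m > m_*` and coupling `J > J_*` ⇒ non-uniqueness of tempered
  Euclidean Gibbs measures; Prop. 3.6: long-range order `P > 0`), in the DLR/path-measure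
  language, whose vocabulary the tree does not have.
* A ground-state (T = 0) long-range-order theorem for the O(2) anharmonic crystal itself was not
  found in print (it is crux `AnchorLRO` of route AtomisticToContinuum/BECSilverBlazeRP, posed on
  even tori exactly as here); the rotator model of this file is its deep-well ("rotor") limit.
* The explicit threshold and constant of [WojtkiewiczPuszStachura2016, Thm. 3.3]
  (`α_c(d) = 𝓘_d²`, `𝓘_d = (2π)^{-d} ∫_{[-π,π]^d} dk / √(Σ_i (1 - cos k_i))`, `𝓘₂ ≈ 0.909`,
  `𝓘₃ ≈ 0.644`): the fact keeps Klein–Perez's `∃ α_c(d)`, which the printed theorem implies.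

## References

* A. Klein, J. F. Perez, *Localization in the ground state of a disordered array of quantum
  rotators*, Commun. Math. Phys. 147 (1992) 241–252: (2.1), (2.3), pp. 242–243 [KleinPerez1992].
* J. Wojtkiewicz, W. Pusz, P. Stachura, *Operator reflection positivity inequalities and their
  applications to interacting quantum rotors*, Rep. Math. Phys. 77 (2016) 183–209
  (arXiv:1507.03079): §3.1, Thm. 3.1, Prop. 3.2, Thm. 3.3, Lemma 3.4 [WojtkiewiczPuszStachura2016].
* J. Wojtkiewicz, *Long range order in the ground state of quantum interacting rotors in two
  dimensions*, Physica A 391 (2012) 5918–5925, Thm. 1 [Wojtkiewicz2012].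
* W. Driessler, L. Landau, J. F. Perez, *Estimates of critical lengths and critical temperatures
  for classical and quantum lattice systems*, J. Stat. Phys. 20 (1979) 123–162
  [DriesslerLandauPerez1979].
* L. A. Pastur, B. A. Khoruzhenko, Theor. Math. Phys. 73 (1987) 1094–1104 [PasturKhoruzhenko1987];
  A. Kargol, Y. Kondratiev, Y. Kozitsky, Rev. Math. Phys. 20 (2008) 529–595 (arXiv:0710.2303).
-/

noncomputable section

open MeasureTheory Filter Finset
open scoped ENNReal NNReal Topology

namespace Literature.MathematicalPhysics.QuantumLattice

namespace QuantumRotor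

/-! ### Sites, boxes, nearest neighbours -/

/-- Nearest neighbours in `ℤ^d`: `‖x - y‖₁ = 1` (a decidable ℓ¹ rendering of the adjacency of
the hypercubic lattice graph `Literature.Probability.LatticeModels.zdGraph d`). [folklore] -/
def IsNearestNeighbour {d : ℕ} (x y : Fin d → ℤ) : Prop := ∑ i, |x i - y i| = 1

/-- Being nearest neighbours is decidable (an equation in `ℤ`). [folklore] -/
instance {d : ℕ} (x y : Fin d → ℤ) : Decidable (IsNearestNeighbour x y) :=
  inferInstanceAs (Decidable (∑ i, |x i - y i| = 1))

/-- The origin lies in every box `Λ_L = {-L, …, L}^d`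
(`Literature.Probability.LatticeModels.box`, the finite volumes with free boundary conditions
used below). [folklore] -/
theorem zero_mem_latticeBox (d L : ℕ) :
    (0 : Fin d → ℤ) ∈ Literature.Probability.LatticeModels.box d L :=
  Literature.Probability.LatticeModels.mem_box.2 fun _ => ⟨by simp, by simp⟩

/-! ### Trial states and the energy form on a finite volume -/

variable (Λ : Type) [Fintype Λ] [DecidableEq Λ]

/-- The fundamental cell `[-π, π)^Λ` of the configuration torus `(ℝ/2πℤ)^Λ` of the angles.
[cite: KleinPerez1992, §2 (2.1) (ℋ_x = L²[-π, +π])] -/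
def angleCell : Set (Λ → ℝ) := {φ | ∀ x, φ x ∈ Set.Ico (-Real.pi) Real.pi}

/-- Admissible trial wave functions of the rotators on the sites `Λ`: `Ψ : ℝ^Λ → ℂ` of class
`C¹`, `2π`-periodic in every angle (the periodic boundary condition of `-∂²/∂φ(x)²`, whose
spectrum is `{n² : n ∈ ℤ}`), normalised on the cell `[-π, π)^Λ`. A form core of `H_Λ`.
[cite: KleinPerez1992, §2 (2.1)] -/
structure TrialState where
  /-- The wave function `Ψ(φ)`, `φ = (φ(x))_{x ∈ Λ}`. -/
  ψ : (Λ → ℝ) → ℂ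
  /-- `Ψ` is `C¹`. -/
  contDiff : ContDiff ℝ 1 ψ
  /-- `2π`-periodicity in every angle. -/
  periodic : ∀ (φ : Λ → ℝ) (x : Λ), ψ (φ + Pi.single x (2 * Real.pi)) = ψ φ
  /-- Normalisation `∫_{[-π,π)^Λ} |Ψ|² = 1`. -/
  norm_eq : ∫⁻ φ in angleCell Λ, (‖ψ φ‖₊ : ℝ≥0∞) ^ 2 = 1

variable {Λ}

/-- The energy form of the ferromagnetic quantum rotators with inverse moment of inertia `h`,
coupling `J` and neighbour relation `nn` (symmetric; every bond is counted twice in the double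
sum, whence `J/2`), shifted by the constant `J·#bonds` so as to be non-negative:
`𝓔(Ψ) = ∫_{[-π,π)^Λ} (h/2) Σ_x |∂_{φ(x)}Ψ|² + (J/2) Σ_x Σ_{y ∼ x} (1 - cos(φ(x) - φ(y))) |Ψ|²`,
the quadratic form of `H_Λ + J·#bonds`, `H_Λ = Σ_x (h/2)(-∂²_{φ(x)}) - J Σ_{⟨x,y⟩} cos(φ(x) - φ(y))`.
[cite: KleinPerez1992, §2 (2.1) and Remark] -/
def energy (h J : ℝ) (nn : Λ → Λ → Prop) [DecidableRel nn] (Ψ : TrialState Λ) : ℝ≥0∞ :=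
  ∫⁻ φ in angleCell Λ,
    ENNReal.ofReal (h / 2) * (∑ x, (‖fderiv ℝ Ψ.ψ φ (Pi.single x 1)‖₊ : ℝ≥0∞) ^ 2) +
      ENNReal.ofReal ((J / 2) * ∑ x, ∑ y ∈ univ.filter (nn x), (1 - Real.cos (φ x - φ y))) *
        (‖Ψ.ψ φ‖₊ : ℝ≥0∞) ^ 2

/-- The (shifted) ground-state energy `E₀ = inf_Ψ 𝓔(Ψ) = inf spec (H_Λ + J·#bonds)`.
[cite: KleinPerez1992, §2 p. 242 (the ground state of H_Λ)] -/
def groundStateEnergy (h J : ℝ) (nn : Λ → Λ → Prop) [DecidableRel nn] : ℝ≥0∞ :=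
  ⨅ Ψ : TrialState Λ, energy h J nn Ψ

/-- The expectation `⟨cos(φ(x) - φ(y))⟩_Ψ = ∫ cos(φ(x) - φ(y)) |Ψ(φ)|² dφ` in a trial state.
[cite: KleinPerez1992, §2 (2.3)] -/
def cosCorrelation (Ψ : TrialState Λ) (x y : Λ) : ℝ :=
  ∫ φ in angleCell Λ, Real.cos (φ x - φ y) * ‖Ψ.ψ φ‖ ^ 2

/-- The **ground-state correlation** `⟨cos(φ(x) - φ(y))⟩_Λ = (Ω_Λ, cos(φ(x) - φ(y)) Ω_Λ)` of
(2.3), rendered variationally as `inf_{δ > 0} sup {⟨cos(φ_x - φ_y)⟩_Ψ : 𝓔(Ψ) ≤ E₀ + δ}`: since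
`H_Λ` has discrete spectrum and a unique ground state `Ω_Λ` (Klein–Perez, p. 242), near-minimisers
of the energy form converge to `Ω_Λ` and this number is the ground-state expectation of the
bounded observable `cos(φ(x) - φ(y))`. [cite: KleinPerez1992, §2 (2.3) and p. 242] -/
def groundStateCorrelation (h J : ℝ) (nn : Λ → Λ → Prop) [DecidableRel nn] (x y : Λ) : ℝ :=
  ⨅ δ : {δ : ℝ // 0 < δ},
    ⨆ Ψ : {Ψ : TrialState Λ //
        energy h J nn Ψ ≤ groundStateEnergy h J nn + ENNReal.ofReal δ.1},
      cosCorrelation Ψ.1 x y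

/-! ### Boxes in `ℤ^d` and the infinite-volume correlation (free boundary conditions) -/

/-- The sites of the box `Λ_L = {-L, …, L}^d` (`Literature.Probability.LatticeModels.box d L`) as a
type. [folklore] -/
abbrev BoxSite (d L : ℕ) : Type := {x : Fin d → ℤ // x ∈ Literature.Probability.LatticeModels.box d L}

/-- The ground-state correlation `⟨cos(φ(x) - φ(y))⟩_{Λ_L}` of the homogeneous rotators
(`h(x) ≡ h`) in the box `Λ_L = {-L,…,L}^d` with free boundary conditions (nearest-neighbour bonds
inside the box). [cite: KleinPerez1992, §2 (2.1), (2.3)] -/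
def boxCorrelation (d L : ℕ) (h J : ℝ) (x y : BoxSite d L) : ℝ :=
  groundStateCorrelation h J (fun a b : BoxSite d L => IsNearestNeighbour a.1 b.1) x y

/-- The **infinite-volume ground-state correlation** `G(x, y) = lim_{Λ ↑ ℤ^d} ⟨cos(φ(x) - φ(y))⟩_Λ`,
rendered as the supremum over the boxes containing `x` and `y` — the limit, since the
correlations (2.3) "are monotonically increasing in `Λ`" (Klein–Perez, p. 243, from correlation
inequalities in the path-space representation). [cite: KleinPerez1992, §2 p. 243] -/
def infiniteVolumeCorrelation (d : ℕ) (h J : ℝ) (x y : Fin d → ℤ) : ℝ :=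
  ⨆ L : {L : ℕ // x ∈ Literature.Probability.LatticeModels.box d L ∧
      y ∈ Literature.Probability.LatticeModels.box d L},
    boxCorrelation d L.1 h J ⟨x, L.2.1⟩ ⟨y, L.2.2⟩

/-! ### API -/

/-- The energy form with `J = 0` has no interaction term. [folklore] -/
theorem energy_zero_coupling (h : ℝ) (nn : Λ → Λ → Prop) [DecidableRel nn] (Ψ : TrialState Λ) :
    energy h 0 nn Ψ =
      ∫⁻ φ in angleCell Λ,
        ENNReal.ofReal (h / 2) * (∑ x, (‖fderiv ℝ Ψ.ψ φ (Pi.single x 1)‖₊ : ℝ≥0∞) ^ 2) := by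
  simp [energy]

/-- The ground-state energy is a lower bound for the energy of every trial state. [folklore] -/
theorem groundStateEnergy_le (h J : ℝ) (nn : Λ → Λ → Prop) [DecidableRel nn] (Ψ : TrialState Λ) :
    groundStateEnergy h J nn ≤ energy h J nn Ψ :=
  iInf_le _ Ψ

/-! ### Periodic boundary conditions: the object of the published theorems

The sources that PROVE ground-state long-range order for (2.1) — Driessler–Landau–Perez 1979
(Klein–Perez's [6]), Wojtkiewicz 2012 (Thm. 1, `d = 2`) and Wojtkiewicz–Pusz–Stachura 2016
(Thm. 3.3: every `d` with `𝓘_d < ∞`, i.e. `d ≥ 2`) — work by reflection positivity on the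
discrete TORUS `Λ = {-N+1, …, N}^d` of even side `2N` (periodic nearest neighbours,
[WojtkiewiczPuszStachura2016, §3.1 (HamRot)]: `H = -(1/2I) Σ_x ∂²/∂φ_x² - J Σ_{⟨xy⟩} cos(φ_x - φ_y)`,
i.e. (2.1) with `I = 1/h`) and conclude a positive ORDER PARAMETER in the (unique,
[ibid., Prop. 3.2]; smooth, [ibid., Thm. 3.1]) ground state: if
`√(IJ) > 𝓘_d := (2π)^{-d} ∫_{[-π,π]^d} dk/√(𝓔(k))`, `𝓔(k) = Σ_i (1 - cos k_i)`, "then there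
exists `C > 0` such that, for sufficiently large `|Λ|`: `⟨(|Λ|⁻¹ Σ_{x ∈ Λ} cos φ_x)²⟩ ≥ C`"
[ibid., Thm. 3.3]; by the rotation symmetry of the unique ground state
(`⟨ŝˣ_k (ŝˣ_k)*⟩ = ⟨ŝʸ_k (ŝʸ_k)*⟩`, [ibid., Lemma 3.4]) this is
`|Λ|⁻² Σ_{x,y ∈ Λ} ⟨cos(φ_x - φ_y)⟩_Λ = 2 ⟨(|Λ|⁻¹ Σ_x cos φ_x)²⟩ ≥ 2C` on all large even tori,
whence `liminf_k (2k)^{-2d} Σ_{x,y} ⟨cos(φ_x - φ_y)⟩_{(ℤ/2kℤ)^d} ≥ 2C > 0` for `J/h = IJ > 𝓘_d²`. -/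

/-- The ground-state correlation `⟨cos(φ(x) - φ(y))⟩_Λ` of the homogeneous rotators (2.1) on the
discrete torus `Λ = (ℤ/Lℤ)^d` — PERIODIC boundary conditions, nearest-neighbour bonds of
`Literature.Probability.LatticeModels.torusGraph d L` — in the variational rendering of
`groundStateCorrelation` (the ground state of the torus Hamiltonian is unique,
[WojtkiewiczPuszStachura2016, Prop. 3.2], and smooth, [ibid., Thm. 3.1], hence itself a trial
state of minimal energy); junk value `0` for `L = 0`, where `(ℤ/0ℤ)^d = ℤ^d` is infinite. This is
the object of the published long-range-order theorems (section docstring).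
[cite: WojtkiewiczPuszStachura2016, §3.1 (HamRot), §3.3 (g_k), Thm. 3.3] -/
def torusCorrelation (d L : ℕ) (h J : ℝ)
    (x y : Literature.Probability.LatticeModels.TorusSite d L) : ℝ :=
  if hL : L = 0 then 0
  else
    haveI : NeZero L := ⟨hL⟩
    groundStateCorrelation h J (Literature.Probability.LatticeModels.torusGraph d L).Adj x y

/-- Junk side `L = 0`. [folklore] -/
@[simp] theorem torusCorrelation_zero_side (d : ℕ) (h J : ℝ)
    (x y : Literature.Probability.LatticeModels.TorusSite d 0) :
    torusCorrelation d 0 h J x y = 0 := by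
  simp [torusCorrelation]

/-- On a genuine torus `torusCorrelation` is the variational ground-state correlation with the
periodic nearest-neighbour relation. [cite: WojtkiewiczPuszStachura2016, §3.1] -/
theorem torusCorrelation_of_neZero (d L : ℕ) [NeZero L] (h J : ℝ)
    (x y : Literature.Probability.LatticeModels.TorusSite d L) :
    torusCorrelation d L h J x y =
      groundStateCorrelation h J (Literature.Probability.LatticeModels.torusGraph d L).Adj x y := by
  simp [torusCorrelation, NeZero.ne L]

/-- The even-torus long-range-order predicate of the published theorems, unfolded to Mathlib's
`liminf` (cf. `hasEvenTorusLRO_iff` in `XYOrder.lean`). [folklore] -/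
theorem hasLongRangeOrder_torusCorrelation_iff (d : ℕ) (h J : ℝ) :
    Literature.Probability.LatticeModels.HasLongRangeOrder
        (fun k => Literature.Probability.LatticeModels.halfOpenBox d (2 * k))
        (fun k => torusPullback (fun L x y => torusCorrelation d L h J x y) (2 * k)) ↔
      0 < liminf (fun k : ℕ =>
        (∑ x ∈ Literature.Probability.LatticeModels.halfOpenBox d (2 * k),
          ∑ y ∈ Literature.Probability.LatticeModels.halfOpenBox d (2 * k),
            torusCorrelation d (2 * k) h J
              (Literature.Probability.LatticeModels.Torus.proj (2 * k) x)
              (Literature.Probability.LatticeModels.Torus.proj (2 * k) y)) /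
          ((Literature.Probability.LatticeModels.halfOpenBox d (2 * k)).card : ℝ) ^ 2) atTop :=
  Iff.rfl

/-! ### The named fact -/

/-- NAMED FACT — **ground-state long-range order of ferromagnetic quantum rotators, `d ≥ 2`**.
Klein–Perez 1992, §2, p. 243, for the homogeneous model `h(x) ≡ h` of (2.1): "In its ground state
for `d ≥ 2`, it exhibits a phase transition with long range order for `α = J/h > α_c(d)`. This
follows from the path space representation developed in Sect. 3 and standard techniques [6]"
([6] = Driessler–Landau–Perez 1979: reflection positivity and infrared bounds). Rendered in the
form in which it is PROVED in print — Wojtkiewicz–Pusz–Stachura 2016, Thm. 3.3 with Lemma 3.4 and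
Prop. 3.2 (all `d` with `𝓘_d < ∞`, i.e. `d ≥ 2`; `d = 2`: Wojtkiewicz 2012, Thm. 1), periodic
boundary conditions, see the section docstring above —: for every `d ≥ 2` there is `α_c > 0`
(in print `α_c = 𝓘_d²`) such that for `h, J > 0` with `J/h > α_c` the ground-state correlations
of (2.1) on the even discrete tori `(ℤ/2kℤ)^d` have long-range order,
`liminf_k (2k)^{-2d} Σ_{x,y ∈ (ℤ/2kℤ)^d} ⟨cos(φ_x - φ_y)⟩_{(ℤ/2kℤ)^d} > 0`
(`Literature.Probability.LatticeModels.HasLongRangeOrder` of the pull-back `torusPullback` over the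
fundamental domains `halfOpenBox d (2k)`; the `HasEvenTorusLRO` shape of `XYOrder.lean`).
Restated 2026-08-15 from an earlier free-boundary two-point rendering (`G(0, y) ↛ 0` for
`infiniteVolumeCorrelation`), which no source proves (module docstring, "What is NOT here").
Calibration fact for crux `AnchorLRO` of route AtomisticToContinuum/BECSilverBlazeRP (posed on even
tori; the rotator is the deep-well limit of the O(2) anharmonic crystal). Users take
`(hKP : KleinPerez1992_rotorGroundStateLRO)`.
[cite: WojtkiewiczPuszStachura2016, Thm. 3.3 (with Lemma 3.4, Prop. 3.2); KleinPerez1992, §2 p. 243; Wojtkiewicz2012, Thm. 1; DriesslerLandauPerez1979] -/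
def KleinPerez1992_rotorGroundStateLRO : Prop :=
  ∀ d : ℕ, 2 ≤ d → ∃ αc : ℝ, 0 < αc ∧ ∀ h J : ℝ, 0 < h → 0 < J → αc < J / h →
    Literature.Probability.LatticeModels.HasLongRangeOrder
      (fun k => Literature.Probability.LatticeModels.halfOpenBox d (2 * k))
      (fun k => torusPullback (fun L x y => torusCorrelation d L h J x y) (2 * k))

/-- The named fact unfolded to Mathlib's `liminf`: above threshold,
`0 < liminf_k |Λ_{2k}|⁻² Σ_{x,y ∈ Λ_{2k}} ⟨cos(φ_x - φ_y)⟩_{(ℤ/2kℤ)^d}`, `Λ_{2k} = {0,…,2k-1}^d`.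
[folklore] -/
theorem kleinPerez1992_rotorGroundStateLRO_iff :
    KleinPerez1992_rotorGroundStateLRO ↔
      ∀ d : ℕ, 2 ≤ d → ∃ αc : ℝ, 0 < αc ∧ ∀ h J : ℝ, 0 < h → 0 < J → αc < J / h →
        0 < liminf (fun k : ℕ =>
          (∑ x ∈ Literature.Probability.LatticeModels.halfOpenBox d (2 * k),
            ∑ y ∈ Literature.Probability.LatticeModels.halfOpenBox d (2 * k),
              torusCorrelation d (2 * k) h J
                (Literature.Probability.LatticeModels.Torus.proj (2 * k) x)
                (Literature.Probability.LatticeModels.Torus.proj (2 * k) y)) /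
            ((Literature.Probability.LatticeModels.halfOpenBox d (2 * k)).card : ℝ) ^ 2) atTop :=
  Iff.rfl

end QuantumRotor

end Literature.MathematicalPhysics.QuantumLattice

end
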